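import Summits.Schanuel.Schanuel.Theorems.SoloInformedBilinearFloor

/-!
# The bilinear floor in factorial base (soloist Proposition FF)

Soloist file (`solo-Schanuel-informed`, residency session s59, 2026-08-22), companion of
`SoloInformedBilinearFloor` (Proposition W: `BilinearFloor :⟺ 1, e, π, eπ` are `ℚ`-linearly
independent — the degree-`(1,1)` truncation of `e ⟂ π`, open).  It kernel-checks the seat's
in-house derivation "atlas r70 addendum / CLAIMS C71" (previously tagged `[D]`, derived on paper
only): the last floor below `e ⟂ π`, read through `n!·e` instead of Euler's continued fraction
of `e`, is an explicit ONE-POINT digit / approximation statement about `π` at `e`'s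
Dirichlet-adjacent rate.  Nothing here is deep; the point is the exact typing, so that the
line of the seat's sharpest statement (§1.3, s32 clause) carries a kernel tag.

## Statements

Let `I n := Σ_{k ≤ n} n!/k! ∈ ℕ` (`facSum`; `I 0 = 1`, `I (n+1) = (n+1)·I n + 1`; OEIS A000522:
`1, 2, 5, 16, 65, 326, …`) and `ε n := n!·e − I n = Σ_{k > n} n!/k!` (`expTail`).

* §1–§2 (elementary analysis).  `(I n : ℝ) = Σ_{k ≤ n} n!/k!` (`cast_facSum`);
  `1/(n+1) ≤ ε n ≤ (n+2)/(n+1)²` (`inv_succ_le_expTail`, `expTail_le`, from Mathlib's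
  `Real.sum_le_exp_of_nonneg` and `Real.exp_bound`); hence `ε n → 0`, `n·ε n → 1` and
  `I n / n! → e` (`tendsto_expTail`, `tendsto_mul_expTail`, `tendsto_facSum_div_factorial`).
* §3 (the identity).  If `a + b·e + c·π + d·eπ = 0` with `a b c d : ℤ`, then for EVERY `n`,
  with `M n := c·n! + d·I n ∈ ℤ` and `N n := −(a·n! + b·I n) ∈ ℤ`, EXACTLY
  `M n · π − N n = −ε n · (b + d·π)` (`factorial_identity`: multiply the relation by `n!` and
  substitute `n!·e = I n + ε n`), and `n!·(c + d·e)·π − N n = −b·ε n` (`factorial_identity'`).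
* §4 (Proposition FF).  `¬ BilinearFloor` ⟹ there are `(c, d) ∈ ℤ² ∖ 0` and `b ∈ ℤ` with
  `b + dπ ≠ 0` such that along the explicit denominators `M n = c·n! + d·I n` one has
  `n · |M n · π − N n| → |b + d·π| ∈ (0, ∞)` (`approx_of_not_bilinearFloor`) — `π` is approximated
  at `e`'s rate `‖M π‖ ≍ 1/n ≍ log log M / log M` along `ℤ·n! + ℤ·I n`; and the non-zero real
  number `x = (c + d·e)·π` satisfies `‖n!·x‖ → 0`, i.e. has eventually-extreme factorial-base digits
  (`factorialDigits_of_not_bilinearFloor`).  Contrapositives (`bilinearFloor_of_no_convergent_rate`,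
  `bilinearFloor_of_no_extreme_factorial_digits`): `BilinearFloor` follows from EITHER one-point
  statement — (i) for every `(c, d) ≠ 0` and every integer sequence `N`, `n·|(c·n! + d·I n)π − N n|`
  converges to no positive real; (ii) no `x ∈ (ℤ + ℤe)π ∖ 0` has `‖n!·x‖ → 0`.  Both are digit /
  approximation statements about the named point `π` of exactly the kind no metric or digit theorem
  in print addresses (the seat's atlas, deaths E19/E20).
* §5.  `𝓔 := {x : ‖n!·x‖ → 0}` is a `ℤ`-module, not a `ℚ`-space: `e ∈ 𝓔` (`tendsto_expTail`) but
  `e/2 ∉ 𝓔` (`not_tendsto_factorial_mul_exp_one_div_two`, via `I n` odd iff `n` even,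
  `odd_facSum_iff`) — so (ii) concerns the specific module `(ℤ + ℤe)π`, not size.

## References

* atlas.md of the seat `solo-Schanuel-informed`, §5 REPAIR CENSUS (s32) r70 addendum; CLAIMS.jsonl C71.
* [Finch2003] S. R. Finch, *Mathematical Constants*, Cambridge Univ. Press 2003, §1.3 (`e`; the
  series `e = Σ 1/k!` and its tail) and §2.22 (joint irrationality questions for `e`, `π`).
* N. J. A. Sloane (ed.), OEIS A000522 (`a(n) = Σ_{k=0..n} n!/k!`; `a(n) = n·a(n−1) + 1`).
-/

noncomputable section

open Filter Topology Finset
open scoped Nat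

namespace Summit.Schanuel.Schanuel.Theorems

/-! ### §1 The integers `I n = Σ_{k ≤ n} n!/k!` -/

/-- `facSum n = Σ_{k ≤ n} n!/k!` (OEIS A000522), defined by `facSum (n+1) = (n+1)·facSum n + 1`. -/
def facSum : ℕ → ℕ
  | 0 => 1
  | n + 1 => (n + 1) * facSum n + 1

/-- `I 0 = 1`. -/
@[simp] theorem facSum_zero : facSum 0 = 1 := rfl

/-- The recursion `I (n+1) = (n+1)·I n + 1`. -/
theorem facSum_succ (n : ℕ) : facSum (n + 1) = (n + 1) * facSum n + 1 := rfl

/-- `I n = Σ_{k ≤ n} n!/k!` as real numbers. -/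
theorem cast_facSum (n : ℕ) :
    (facSum n : ℝ) = ∑ k ∈ range (n + 1), (n ! : ℝ) / k ! := by
  induction n with
  | zero => simp [facSum]
  | succ n ih =>
    rw [facSum_succ, Nat.cast_add, Nat.cast_mul, ih, Finset.sum_range_succ _ (n + 1),
      Finset.mul_sum]
    have hf : ((n + 1)! : ℝ) ≠ 0 := by positivity
    congr 1
    · refine Finset.sum_congr rfl fun k _ => ?_
      rw [Nat.factorial_succ]
      push_cast
      ring
    · rw [div_self hf]
      simp

/-! ### §2 The tail `ε n = n!·e − I n` -/

/-- `expTail n := n!·e − I n` (`= Σ_{k > n} n!/k!`). -/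
def expTail (n : ℕ) : ℝ := n ! * Real.exp 1 - facSum n

/-- `ε n = n!·(e − Σ_{k ≤ n} 1/k!)`. -/
theorem expTail_eq (n : ℕ) :
    expTail n = n ! * (Real.exp 1 - ∑ k ∈ range (n + 1), (1 : ℝ) ^ k / k !) := by
  rw [expTail, cast_facSum, mul_sub, Finset.mul_sum]
  congr 1
  refine Finset.sum_congr rfl fun k _ => ?_
  rw [one_pow, mul_one_div]

/-- Lower bound `ε n ≥ 1/(n+1)` (the first term of the tail). -/
theorem inv_succ_le_expTail (n : ℕ) : 1 / ((n : ℝ) + 1) ≤ expTail n := by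
  have h := Real.sum_le_exp_of_nonneg zero_le_one (n + 2)
  rw [Finset.sum_range_succ] at h
  rw [expTail_eq]
  have hf : (0 : ℝ) < n ! := by positivity
  have key : (1 : ℝ) / (n + 1) = n ! * ((1 : ℝ) ^ (n + 1) / (n + 1)!) := by
    rw [Nat.factorial_succ, one_pow]
    push_cast
    field_simp
  rw [key]
  exact mul_le_mul_of_nonneg_left (by linarith) hf.le

/-- Upper bound `ε n ≤ (n+2)/(n+1)²` (Mathlib's `Real.exp_bound` at `x = 1`). -/
theorem expTail_le (n : ℕ) : expTail n ≤ ((n : ℝ) + 2) / ((n : ℝ) + 1) ^ 2 := by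
  have h := Real.exp_bound (x := 1) (by simp) (Nat.succ_pos n)
  simp only [abs_one, one_pow, one_mul] at h
  have h' := (abs_le.mp h).2
  rw [expTail_eq]
  simp only [one_pow]
  have hf : (0 : ℝ) < n ! := by positivity
  calc (n ! : ℝ) * (Real.exp 1 - ∑ k ∈ range (n + 1), (1 : ℝ) / k !)
      ≤ n ! * (((n + 1).succ : ℕ) / (((n + 1)! : ℕ) * ((n + 1 : ℕ) : ℝ))) :=
        mul_le_mul_of_nonneg_left (by simpa [one_div] using h') hf.le
    _ = ((n : ℝ) + 2) / ((n : ℝ) + 1) ^ 2 := by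
        rw [Nat.factorial_succ]
        push_cast
        field_simp
        ring

/-- `ε n > 0`. -/
theorem expTail_pos (n : ℕ) : 0 < expTail n :=
  lt_of_lt_of_le (by positivity) (inv_succ_le_expTail n)

/-- `ε n → 0`: `e` itself has `‖n!·e‖ → 0` (eventually-extreme factorial digits, all equal to `1`). -/
theorem tendsto_expTail : Tendsto expTail atTop (𝓝 0) := by
  have h2 : Tendsto (fun n : ℕ => (2 : ℝ) * (1 / ((n : ℝ) + 1))) atTop (𝓝 0) := by
    simpa using (tendsto_one_div_add_atTop_nhds_zero_nat).const_mul (2 : ℝ)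
  refine tendsto_of_tendsto_of_tendsto_of_le_of_le' tendsto_const_nhds h2 ?_ ?_
  · exact Eventually.of_forall fun n => (expTail_pos n).le
  · refine Eventually.of_forall fun n => (expTail_le n).trans ?_
    rw [div_le_iff₀ (by positivity)]
    have hn : (0 : ℝ) ≤ n := Nat.cast_nonneg n
    have h1 : (0 : ℝ) < (n : ℝ) + 1 := by positivity
    rw [show (2 : ℝ) * (1 / ((n : ℝ) + 1)) * (((n : ℝ) + 1) ^ 2) = 2 * ((n : ℝ) + 1) by
      field_simp]
    linarith

/-- `n·ε n → 1`. -/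
theorem tendsto_mul_expTail : Tendsto (fun n : ℕ => (n : ℝ) * expTail n) atTop (𝓝 1) := by
  have h1 : Tendsto (fun n : ℕ => (n : ℝ) / ((n : ℝ) + 1)) atTop (𝓝 1) :=
    tendsto_natCast_div_add_atTop 1
  have h3 : Tendsto (fun n : ℕ => (1 : ℝ) + 1 / ((n : ℝ) + 1)) atTop (𝓝 1) := by
    simpa using tendsto_const_nhds.add (tendsto_one_div_add_atTop_nhds_zero_nat (𝕜 := ℝ))
  have h2 : Tendsto (fun n : ℕ => (n : ℝ) * (((n : ℝ) + 2) / ((n : ℝ) + 1) ^ 2)) atTop (𝓝 1) := by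
    have h12 := h1.mul h3
    rw [one_mul] at h12
    refine h12.congr fun n => ?_
    have hn1 : ((n : ℝ) + 1) ≠ 0 := by positivity
    field_simp
    ring
  refine tendsto_of_tendsto_of_tendsto_of_le_of_le' h1 h2 ?_ ?_
  · refine Eventually.of_forall fun n => ?_
    calc (n : ℝ) / ((n : ℝ) + 1) = n * (1 / ((n : ℝ) + 1)) := by ring
      _ ≤ n * expTail n := mul_le_mul_of_nonneg_left (inv_succ_le_expTail n) (Nat.cast_nonneg n)
  · exact Eventually.of_forall fun n =>
      mul_le_mul_of_nonneg_left (expTail_le n) (Nat.cast_nonneg n)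

/-- `I n / n! → e` (`I n` is the integer nearest to `n!·e` from below, at distance `ε n < 1/n`). -/
theorem tendsto_facSum_div_factorial :
    Tendsto (fun n : ℕ => (facSum n : ℝ) / n !) atTop (𝓝 (Real.exp 1)) := by
  have h0 : Tendsto (fun n : ℕ => expTail n / n !) atTop (𝓝 0) := by
    refine tendsto_of_tendsto_of_tendsto_of_le_of_le' tendsto_const_nhds tendsto_expTail ?_ ?_
    · exact Eventually.of_forall fun n => div_nonneg (expTail_pos n).le (by positivity)
    · refine Eventually.of_forall fun n => div_le_self (expTail_pos n).le ?_
      exact_mod_cast Nat.succ_le_of_lt (Nat.factorial_pos n)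
  have h := (tendsto_const_nhds (x := Real.exp 1)).sub h0
  rw [sub_zero] at h
  refine h.congr fun n => ?_
  have hf : (n ! : ℝ) ≠ 0 := by positivity
  unfold expTail
  field_simp
  ring

/-! ### §3 The identity -/

/-- **The exact identity.**  An integer relation `a + be + cπ + deπ = 0`, multiplied by `n!` with
`n!·e = I n + ε n` substituted: `(c·n! + d·I n)·π + (a·n! + b·I n) = −ε n·(b + dπ)`. -/
theorem factorial_identity {a b c d : ℤ}
    (h : (a : ℝ) + b * Real.exp 1 + c * Real.pi + d * (Real.exp 1 * Real.pi) = 0) (n : ℕ) :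
    ((c : ℝ) * n ! + d * facSum n) * Real.pi - (-((a : ℝ) * n ! + b * facSum n))
      = -(expTail n) * (b + d * Real.pi) := by
  unfold expTail
  linear_combination (n ! : ℝ) * h

/-- The same identity read on `x = (c + de)π`: `n!·x − N n = −b·ε n`. -/
theorem factorial_identity' {a b c d : ℤ}
    (h : (a : ℝ) + b * Real.exp 1 + c * Real.pi + d * (Real.exp 1 * Real.pi) = 0) (n : ℕ) :
    (n ! : ℝ) * (((c : ℝ) + d * Real.exp 1) * Real.pi) - (-((a : ℝ) * n ! + b * facSum n))
      = -(b : ℝ) * expTail n := by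
  unfold expTail
  linear_combination (n ! : ℝ) * h

/-- In a non-trivial integer relation `a + be + cπ + deπ = 0` one has `(c, d) ≠ 0` and
`b + dπ ≠ 0` (irrationality of `e` and of `π`). -/
theorem ne_of_relation {a b c d : ℤ}
    (h : (a : ℝ) + b * Real.exp 1 + c * Real.pi + d * (Real.exp 1 * Real.pi) = 0)
    (hne : ¬ (a = 0 ∧ b = 0 ∧ c = 0 ∧ d = 0)) :
    (c ≠ 0 ∨ d ≠ 0) ∧ (b : ℝ) + d * Real.pi ≠ 0 := by
  -- `u + v·x = 0` with `x` irrational forces `u = v = 0`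
  have hirr : ∀ {x : ℝ}, Irrational x → ∀ u v : ℤ, (u : ℝ) + v * x = 0 → u = 0 ∧ v = 0 := by
    intro x hx u v huv
    by_cases hv : v = 0
    · subst hv
      simp only [Int.cast_zero, zero_mul, add_zero, Int.cast_eq_zero] at huv
      exact ⟨huv, rfl⟩
    · exfalso
      refine hx ⟨(-u / v : ℚ), ?_⟩
      have hv' : (v : ℝ) ≠ 0 := by exact_mod_cast hv
      push_cast
      rw [div_eq_iff hv']
      linear_combination -huv
  have hab := hirr Literature.NumberTheory.Transcendental.transcendental_exp_one_holds.irrational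
  have hbd := hirr irrational_pi
  constructor
  · by_contra hcd
    simp only [not_or, not_not] at hcd
    obtain ⟨hc, hd⟩ := hcd
    subst hc; subst hd
    simp only [Int.cast_zero, zero_mul, add_zero] at h
    obtain ⟨ha, hb⟩ := hab a b h
    exact hne ⟨ha, hb, rfl, rfl⟩
  · intro h0
    obtain ⟨hb, hd⟩ := hbd b d h0
    subst hb; subst hd
    simp only [Int.cast_zero, zero_mul, add_zero] at h
    -- now `a + cπ = 0`
    obtain ⟨ha, hc⟩ := hbd a c h
    exact hne ⟨ha, rfl, hc, rfl⟩

/-! ### §4 Proposition FF -/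

/-- **Proposition FF (approximation form).**  If `1, e, π, eπ` are `ℚ`-linearly DEpendent, then
along the explicit integers `M n = c·n! + d·I n` (some `(c, d) ∈ ℤ² ∖ 0`) `π` is approximated at
`e`'s factorial rate: `n·|M n·π − N n| → |b + dπ| ∈ (0, ∞)` for an integer sequence `N` and some
`b ∈ ℤ`, with the exact identity `M n·π − N n = −ε n·(b + dπ)` at every `n`. -/
theorem approx_of_not_bilinearFloor (h : ¬ BilinearFloor) :
    ∃ b c d : ℤ, (c ≠ 0 ∨ d ≠ 0) ∧ (b : ℝ) + d * Real.pi ≠ 0 ∧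
      ∃ N : ℕ → ℤ,
        (∀ n : ℕ, ((c : ℝ) * n ! + d * facSum n) * Real.pi - N n = -(expTail n) * (b + d * Real.pi)) ∧
        Tendsto (fun n : ℕ => (n : ℝ) * |((c : ℝ) * n ! + d * facSum n) * Real.pi - N n|)
          atTop (𝓝 |(b : ℝ) + d * Real.pi|) := by
  rw [bilinearFloor_iff_intForms] at h
  push Not at h
  obtain ⟨a, b, c, d, hrel, hne⟩ := h
  have hne' : ¬ (a = 0 ∧ b = 0 ∧ c = 0 ∧ d = 0) := fun ⟨ha, hb, hc, hd⟩ => hne ha hb hc hd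
  obtain ⟨hcd, hbd⟩ := ne_of_relation hrel hne'
  refine ⟨b, c, d, hcd, hbd, fun n => -(a * n ! + b * facSum n), ?_, ?_⟩
  · intro n
    have := factorial_identity hrel n
    push_cast
    linear_combination this
  · have key : ∀ n : ℕ, (n : ℝ) * |((c : ℝ) * n ! + d * facSum n) * Real.pi
        - ((-(a * n ! + b * facSum n) : ℤ) : ℝ)| = (n * expTail n) * |(b : ℝ) + d * Real.pi| := by
      intro n
      have := factorial_identity hrel n
      push_cast at this ⊢
      rw [this, abs_mul, abs_neg, abs_of_pos (expTail_pos n)]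
      ring
    simp_rw [key]
    simpa using tendsto_mul_expTail.mul_const (|(b : ℝ) + d * Real.pi|)

/-- **Proposition FF (factorial-digit form).**  If `1, e, π, eπ` are `ℚ`-linearly DEpendent, some
non-zero `x = (c + de)π ∈ (ℤ + ℤe)π` has `‖n!·x‖ → 0` — explicitly `n!·x − N n = −b·ε n → 0` —
i.e. eventually-extreme factorial-base digits. -/
theorem factorialDigits_of_not_bilinearFloor (h : ¬ BilinearFloor) :
    ∃ c d : ℤ, (c ≠ 0 ∨ d ≠ 0) ∧ ((c : ℝ) + d * Real.exp 1) * Real.pi ≠ 0 ∧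
      ∃ N : ℕ → ℤ,
        Tendsto (fun n : ℕ => (n ! : ℝ) * (((c : ℝ) + d * Real.exp 1) * Real.pi) - N n)
          atTop (𝓝 0) := by
  rw [bilinearFloor_iff_intForms] at h
  push Not at h
  obtain ⟨a, b, c, d, hrel, hne⟩ := h
  have hne' : ¬ (a = 0 ∧ b = 0 ∧ c = 0 ∧ d = 0) := fun ⟨ha, hb, hc, hd⟩ => hne ha hb hc hd
  obtain ⟨hcd, hbd⟩ := ne_of_relation hrel hne'
  have hx : ((c : ℝ) + d * Real.exp 1) * Real.pi ≠ 0 := by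
    refine mul_ne_zero ?_ Real.pi_ne_zero
    intro h0
    -- `c + de = 0 ⟹ c = d = 0`
    have := ne_of_relation (a := c) (b := d) (c := 0) (d := 0)
      (by push_cast; linear_combination h0)
    rcases hcd with hc | hd
    · exact (this (fun ⟨hc', _⟩ => hc hc')).1.elim (fun h => h rfl) (fun h => h rfl)
    · exact (this (fun ⟨_, hd', _⟩ => hd hd')).1.elim (fun h => h rfl) (fun h => h rfl)
  refine ⟨c, d, hcd, hx, fun n => -(a * n ! + b * facSum n), ?_⟩
  have key : ∀ n : ℕ, (n ! : ℝ) * (((c : ℝ) + d * Real.exp 1) * Real.pi)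
      - ((-(a * n ! + b * facSum n) : ℤ) : ℝ) = -(b : ℝ) * expTail n := by
    intro n
    have := factorial_identity' hrel n
    push_cast at this ⊢
    linear_combination this
  simp_rw [key]
  simpa using tendsto_expTail.const_mul (-(b : ℝ))

/-- **`BilinearFloor` from a one-point approximation statement**: if for every `(c, d) ∈ ℤ² ∖ 0`
and every integer sequence `N` the sequence `n·|(c·n! + d·I n)·π − N n|` converges to NO
positive real number, then `1, e, π, eπ` are `ℚ`-linearly independent. -/
theorem bilinearFloor_of_no_convergent_rate
    (h : ∀ c d : ℤ, (c ≠ 0 ∨ d ≠ 0) → ∀ (N : ℕ → ℤ) (L : ℝ), 0 < L →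
      ¬ Tendsto (fun n : ℕ => (n : ℝ) * |((c : ℝ) * n ! + d * facSum n) * Real.pi - N n|)
          atTop (𝓝 L)) :
    BilinearFloor := by
  by_contra hW
  obtain ⟨b, c, d, hcd, hbd, N, -, hlim⟩ := approx_of_not_bilinearFloor hW
  exact h c d hcd N _ (abs_pos.mpr hbd) hlim

/-- **`BilinearFloor` from a one-point digit statement**: if no non-zero `x ∈ (ℤ + ℤe)·π` has
`‖n!·x‖ → 0` (eventually-extreme factorial-base digits), then `1, e, π, eπ` are `ℚ`-linearly
independent. -/
theorem bilinearFloor_of_no_extreme_factorial_digits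
    (h : ∀ c d : ℤ, (c ≠ 0 ∨ d ≠ 0) → ∀ N : ℕ → ℤ,
      ¬ Tendsto (fun n : ℕ => (n ! : ℝ) * (((c : ℝ) + d * Real.exp 1) * Real.pi) - N n)
          atTop (𝓝 0)) :
    BilinearFloor := by
  by_contra hW
  obtain ⟨c, d, hcd, -, N, hlim⟩ := factorialDigits_of_not_bilinearFloor hW
  exact h c d hcd N hlim

/-! ### §5 The module `𝓔 = {x : ‖n!·x‖ → 0}` is not a `ℚ`-subspace: `e ∈ 𝓔` but `e/2 ∉ 𝓔` -/

/-- `I n` is odd exactly when `n` is even (from `I (n+1) = (n+1)·I n + 1`). -/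
theorem odd_facSum_iff : ∀ n : ℕ, Odd (facSum n) ↔ Even n
  | 0 => by simp [facSum]
  | n + 1 => by
    have ih := odd_facSum_iff n
    rw [facSum_succ, Nat.odd_add_one, Nat.odd_mul, Nat.even_add_one]
    rcases Nat.even_or_odd n with hn | hn
    · -- `n` even: `I n` odd, `n+1` odd, product odd, `I (n+1)` even; `n+1` is odd i.e. not even
      have h1 : Odd (n + 1) := hn.add_one
      simp only [h1, ih.mpr hn, and_self, not_true_eq_false, false_iff, not_not]
      exact hn
    · -- `n` odd: `n+1` even, product even, `I (n+1)` odd; and `n` is not even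
      have h1 : ¬ Odd (n + 1) := Nat.not_odd_iff_even.mpr hn.add_one
      simp only [h1, false_and, not_false_eq_true, true_iff]
      exact Nat.not_even_iff_odd.mpr hn

/-- **`e/2 ∉ 𝓔`**: no integer sequence `N` has `n!·(e/2) − N n → 0` — along even `n`,
`n!·e/2 = I n/2 + ε n/2` with `I n` odd, so `‖n!·e/2‖ → 1/2`.  Together with `‖n!·e‖ = ε n → 0`
(`tendsto_expTail`) this shows that `𝓔 = {x : ‖n!·x‖ → 0}` is a `ℤ`-module but not a `ℚ`-subspace
of `ℝ`, so the digit statement of Proposition FF concerns the specific module `(ℤ + ℤe)·π`. -/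
theorem not_tendsto_factorial_mul_exp_one_div_two (N : ℕ → ℤ) :
    ¬ Tendsto (fun n : ℕ => (n ! : ℝ) * (Real.exp 1 / 2) - N n) atTop (𝓝 0) := by
  intro h
  have h1 := (Metric.tendsto_atTop.mp h) (1 / 4) (by norm_num)
  have h2 := (Metric.tendsto_atTop.mp tendsto_expTail) (1 / 2) (by norm_num)
  obtain ⟨n₁, hn₁⟩ := h1
  obtain ⟨n₂, hn₂⟩ := h2
  -- an even index beyond both thresholds
  obtain ⟨m, hm1, hm2⟩ : ∃ m : ℕ, n₁ ≤ m ∧ n₂ ≤ m := ⟨max n₁ n₂, le_max_left _ _, le_max_right _ _⟩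
  set n := 2 * m with hn
  have hn1 : n₁ ≤ n := by omega
  have hn2 : n₂ ≤ n := by omega
  have heven : Even n := ⟨m, by omega⟩
  have hodd : Odd (facSum n) := (odd_facSum_iff n).mpr heven
  specialize hn₁ n hn1
  specialize hn₂ n hn2
  rw [Real.dist_eq, sub_zero] at hn₁ hn₂
  -- `n!·e/2 − N n = (I n − 2·N n)/2 + ε n/2`
  have hid : (n ! : ℝ) * (Real.exp 1 / 2) - N n = ((facSum n : ℝ) - 2 * N n) / 2 + expTail n / 2 := by
    unfold expTail
    ring
  obtain ⟨k, hk⟩ := hodd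
  -- the odd integer `I n − 2 N n = 2 (k − N n) + 1` has absolute value `≥ 1`
  have hint : (1 : ℝ) ≤ |((facSum n : ℝ) - 2 * N n)| := by
    have : ((facSum n : ℝ) - 2 * N n) = ((2 * ((k : ℤ) - N n) + 1 : ℤ) : ℝ) := by
      push_cast
      rw [show (facSum n : ℝ) = ((facSum n : ℕ) : ℝ) from rfl, hk]
      push_cast
      ring
    rw [this, ← Int.cast_abs, ← Int.cast_one, Int.cast_le]
    exact Int.one_le_abs (by omega)
  have hε : |expTail n| < 1 / 2 := hn₂
  have hεpos := expTail_pos n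
  rw [hid] at hn₁
  -- `|odd/2 + ε/2| ≥ 1/2 − ε/2 > 1/4`, contradiction
  have htri : |((facSum n : ℝ) - 2 * N n) / 2| - |expTail n / 2|
      ≤ |((facSum n : ℝ) - 2 * N n) / 2 + expTail n / 2| := by
    have := abs_sub_abs_le_abs_sub (((facSum n : ℝ) - 2 * N n) / 2) (-(expTail n / 2))
    simpa [abs_neg, sub_neg_eq_add] using this
  rw [abs_div, abs_div, abs_two] at htri
  rw [abs_of_pos hεpos] at hε htri
  linarith

end Summit.Schanuel.Schanuel.Theorems

end
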